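import Literature.Computability.Complexity.GateEliminationCase54Q11

/-!
# Gate elimination: Cases 5.4.1.4.1.3/4 of Li–Yang's Theorem 4.1

"When `B` is an ⊕-type gate and `t` is unprotected, we can first trivialize `G` by constant
substitution to `y`, making `x` a `1`-variable, then trivialize `B` by affine substitution
`x ← t`. These `2` substitutions make `3` variables (`x`, `y` and `t`) non-influential, hence
`Δμ ≥ 3α_I/2 ≥ δ`." "Assume that `B` is an ⊕-type gate and `t` is protected. … we can first perform a
constant substitution to its couple to make `t` unprotected, then apply Case 5.4.1.4.1.3. This
will allow us to make `4` variables non-influential by `3` substitutions." (ECCC TR21-023, §4.1,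
Cases 5.4.1.4.1.3, 5.4.1.4.1.4.) PROVED here: the common core `quad13_core` (on any fair circuit
with the local configuration), and `stepGoal_quad13` (hypothesis `hQ13` of
`stepGoal_quadratic_aux`).

## References

* J. Li, T. Yang, *3.1n − o(n) circuit lower bounds for explicit functions*, STOC 2022;
  ECCC TR21-023, §2.4, §4.1 (Cases 5.4.1.4.1.3/4), Lemma 3.11.
-/

namespace Literature.Computability.Complexity

open Finset

/-- `3δ ≤ 4α_I` (from the term `α_I/3` of `δ`). [cite: LiYang2022, Lemma 3.11 / proof of Thm. 1.1] -/
theorem three_liYangDelta_le_four (αφ αI αQ : ℝ) : 3 * liYangDelta αφ αI αQ ≤ 4 * αI := by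
  unfold liYangDelta
  have : min (αI / 3) (min (2 - 2 * αφ + αQ) (min (4 - 4 * αφ) (min (3 + αφ) (min (5 - αQ) ((5 - 2 * αφ + αQ) / 2))))) ≤
      αI / 3 := min_le_left _ _
  linarith

namespace Semicircuit

variable {n : ℕ} {f : (Fin n → ZMod 2) → Bool} {d : ℕ} {αφ αI αQ : ℝ}

/-- A potential-non-increasing packing after the affine substitution `x_j ← x_k ⊕ c` when no ∧-type
gate reads the target afterwards (new troubled gates read the target). [cite: LiYang2022, §3.3, Prop. 3.10] -/
theorem exists_packing_substVar_of_not_and (D : Semicircuit n) (j k : Fin n) (c : Bool) (hjk : k ≠ j)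
    {P : Finset (Fin D.m × Fin D.m)} (hP : D.IsPacking P)
    (hk : ∀ g a, (D.substVar j k c).arg g a = .var k → ¬ IsAndOp ((D.substVar j k c).op g)) :
    ∃ P' : Finset (Fin D.m × Fin D.m), (D.substVar j k c).IsPacking P' ∧ (D.substVar j k c).potential P' ≤ D.potential P := by
  classical
  have hcover : ∀ g, (D.substVar j k c).Troubled g → ¬ D.Troubled (id g) → g ∈ (∅ : Finset (Fin D.m)) ∨ g ∈ (∅ : Finset (Fin D.m)) := by
    intro g hg hgT
    exfalso
    have hcb := D.causedBy_of_new_troubled_substVar j k c hjk hg hgT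
    rcases hcb with h | ⟨z, hz, a, ha⟩
    · cases h
    · cases hz
      exact hk g a ha hg.1
  have hadj : ∀ g g', (D.substVar j k c).Troubled g → (D.substVar j k c).Troubled g' → D.Troubled (id g) → D.Troubled (id g') →
      D.Adjacent (id g) (id g') → (D.substVar j k c).Adjacent g g' := by
    intro g g' _ _ _ _ ⟨z, hz, hz'⟩
    by_cases hzj : z = j
    · subst hzj
      exact ⟨k, D.reads_target_substVar_of_reads z k c hz, D.reads_target_substVar_of_reads z k c hz'⟩
    · exact ⟨z, D.reads_var_substVar_of_ne j k c hzj hz, D.reads_var_substVar_of_ne j k c hzj hz'⟩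
  obtain ⟨P', hP', hpot⟩ := exists_packing_transfer D (D.substVar j k c) id (fun _ _ h => h) hP
    (fun p _ => ⟨⟨p.1, rfl⟩, ⟨p.2, rfl⟩⟩) hadj ∅ ∅ hcover (Or.inl (by simp)) (Or.inl (by simp))
  refine ⟨P', hP', ?_⟩
  simpa using hpot

/-- **Core of Cases 5.4.1.4.1.3/4**: in a fair circuit computing `f` on `R₀` with an ∧-type gate
`G` reading the free unprotected variables `x` (at `aX`) and `y`, and an ⊕-type gate `B` reading
`x` (at `aB`) and the free unprotected `1`-variable `t`, where `x` is read only by `G` and `B`: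
substitute the killing constant to `y` (eliminating `G`), then `x ← t`, making `B` a constant gate,
eliminated: `y`, `x`, `t` leave the influential set, two substitutions, `μ' ≤ μ(C₀, P₀, R₀) - 3α_I`.
[cite: LiYang2022, §4.1 (Case 5.4.1.4.1.3)] -/
theorem quad13_core {C₀ : Semicircuit n} {R₀ : RdqSource n} (hf : IsAffineDisperser f d) (hd₀ : 2 * d + 2 ≤ R₀.dim)
    (hF₀ : C₀.Fair) (hC₀ : C₀.ComputesRestr f R₀)
    {P₀ : Finset (Fin C₀.m × Fin C₀.m)} (hP₀ : C₀.IsPacking P₀) (hφ : 0 ≤ αφ) (hφ1 : αφ ≤ 1) (hI : 0 ≤ αI) (αQ : ℝ)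
    {G B : Fin C₀.m} {x y t : Fin n} {aX aB : Fin 2} (hand : IsAndOp (C₀.op G)) (hGx : C₀.arg G aX = .var x)
    (hGy : C₀.arg G aX.rev = .var y) (hBx : C₀.arg B aB = .var x) (hBt : C₀.arg B aB.rev = .var t)
    (hBxor : IsXorOp (C₀.op B)) (hBG : B ≠ G) (hxy : x ≠ y) (htx : t ≠ x) (hty : t ≠ y)
    (hreadx : ∀ k a, C₀.arg k a = .var x → k = G ∨ k = B) (ht1 : C₀.fanout (.var t) = 1)
    (hx : R₀.Free x) (hxp : ¬ R₀.Protected x) (hy : R₀.Free y) (hyp : ¬ R₀.Protected y) (ht : R₀.Free t)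
    (htp : ¬ R₀.Protected t) (hGout : C₀.out ≠ .gate G) :
    ∃ (C' : Semicircuit n) (R' : RdqSource n) (P' : Finset (Fin C'.m × Fin C'.m)),
      C'.Fair ∧ C'.ComputesRestr f R' ∧ C'.IsPacking P' ∧ R'.dim + 2 = R₀.dim ∧
      C'.measure αφ αI αQ P' R' ≤ C₀.measure αφ αI αQ P₀ R₀ - 3 * αI := by
  classical
  have hGK : G ∉ C₀.xorPart := C₀.not_mem_xorPart_of_isAndOp hand
  obtain ⟨ko, hko⟩ := exists_out_eq_gate' hf hF₀ hC₀ (by omega)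
  -- step 1: `y := cy`, the killing constant of `G`
  obtain ⟨cy, hcy⟩ := exists_trivializing hand aX.rev
  let cy' : ZMod 2 := finTwoEquiv.symm cy
  have hcy' : finTwoEquiv cy' = cy := finTwoEquiv.apply_symm_apply cy
  let C₁ := C₀.substConst y (finTwoEquiv cy')
  let R₁ := R₀.assignFree y cy' hy hyp
  have hF₁ : C₁.Fair := hF₀.substConst y _
  have hC₁ : C₁.ComputesRestr f R₁ := hC₀.substConst_assignFree hy hyp cy'
  have hP₁ : C₁.IsPacking (C₀.substConstPacking y (finTwoEquiv cy') P₀) := hP₀.substConst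
  have hd₁ : 2 * d ≤ R₁.dim := by have := RdqSource.dim_assignFree (b := cy') hy hyp; change R₁.dim + 1 = R₀.dim at this; omega
  have hC₁var : ∀ {k : Fin C₀.m} {a : Fin 2} {v : Fin n}, v ≠ y → (C₁.arg k a = .var v ↔ C₀.arg k a = .var v) := by
    intro k a v hvy
    show (C₀.arg k a).substConst y _ = .var v ↔ _
    cases hka : C₀.arg k a with
    | const c => exact ⟨(fun h => by cases h), fun h => by cases h⟩
    | var i =>
      by_cases hiy : i = y
      · rw [hiy, Node.substConst_var_self]; exact ⟨(fun h => by cases h), fun h => by cases h; exact absurd rfl hvy⟩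
      · rw [Node.substConst_var_of_ne hiy]
    | gate g => exact ⟨(fun h => by cases h), fun h => by cases h⟩
  have hGy₁ : C₁.arg G aX.rev = .const cy := by
    show (C₀.arg G aX.rev).substConst y _ = _; rw [hGy, Node.substConst_var_self, hcy']
  have hGx₁ : C₁.arg G aX = .var x := (hC₁var (fun h => hxy h)).mpr hGx
  have htrivG : C₁.liveFn G aX.rev cy false = C₁.liveFn G aX.rev cy true := hcy
  have hC₁out : C₁.out = .gate ko := by show C₀.out.substConst y _ = _; rw [hko]; rfl
  have hout₁G : C₁.out ≠ .gate G := by rw [hC₁out]; exact fun h => hGout (by rw [hko]; exact h)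
  let E₁ := elimDataWTriv hF₁ hC₁ hP₁ hGy₁ htrivG hout₁G hφ hI αQ
  have hr₁ : ∃ c₁, E₁.repl = .const c₁ := ⟨_, rfl⟩
  obtain ⟨kB₁, hkB₁⟩ := E₁.ι_surj B hBG
  have hB₁x : E₁.C'.arg kB₁ aB = .var x := by rw [E₁.arg_eq_var_iff, hkB₁]; exact Or.inl ((hC₁var (fun h => hxy h)).mpr hBx)
  have hB₁t : E₁.C'.arg kB₁ aB.rev = .var t := by rw [E₁.arg_eq_var_iff, hkB₁]; exact Or.inl ((hC₁var hty).mpr hBt)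
  have hxorB₁ : IsXorOp (E₁.C'.op kB₁) := E₁.isXorOp_of (by rw [hkB₁]; exact hBxor)
  -- readers of `x` and `t` in `E₁.C'`: only `B`
  have hreadx₁ : ∀ k a, E₁.C'.arg k a = .var x → k = kB₁ := by
    intro k a h
    obtain ⟨c₁, hc₁⟩ := hr₁
    rw [E₁.arg_eq_var_iff] at h
    rcases h with h | ⟨-, h⟩
    swap; · rw [hc₁] at h; cases h
    rw [hC₁var (fun h' => hxy h')] at h
    rcases hreadx _ a h with h' | h'
    · exact absurd h' (E₁.ι_ne k)
    · exact E₁.ι_injective (h'.trans hkB₁.symm)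
  have hreadt₁ : ∀ k a, E₁.C'.arg k a = .var t → k = kB₁ := by
    intro k a h
    obtain ⟨c₁, hc₁⟩ := hr₁
    rw [E₁.arg_eq_var_iff] at h
    rcases h with h | ⟨-, h⟩
    swap; · rw [hc₁] at h; cases h
    rw [hC₁var hty] at h
    by_contra hk
    have hne : E₁.ι k ≠ B := fun h' => hk (E₁.ι_injective (h'.trans hkB₁.symm))
    have := two_le_fanout hBt h hne.symm
    omega
  -- step 2: `x ← t`
  have hx₁ : R₁.Free x := (RdqSource.free_assignFree_iff hy hyp x).mpr ⟨hx, hxy⟩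
  have hxp₁ : ¬ R₁.Protected x := fun h => hxp ((RdqSource.protected_assignFree_iff hy hyp x).mp h)
  have ht₁ : R₁.Free t := (RdqSource.free_assignFree_iff hy hyp t).mpr ⟨ht, hty⟩
  let Eq : LinEq n := ⟨{t}, 0⟩
  have hEq : ∀ i ∈ Eq.support, R₁.lin i = none ∧ i ≠ x := by
    intro i hi
    have : i = t := by simpa [Eq] using hi
    subst this
    exact ⟨ht₁.1, htx⟩
  let R₂ := R₁.assignLin x Eq hx₁ hxp₁ hEq
  have hsol : ∀ v, v ∈ R₂.Sol ↔ v ∈ R₁.Sol ∧ v x = v t + 0 := by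
    intro v
    rw [RdqSource.mem_sol_assignLin_iff]
    have : Eq.eval v = v t + 0 := by
      show (0 : ZMod 2) + ∑ i ∈ ({t} : Finset (Fin n)), v i = _
      rw [sum_singleton, add_comm]
    rw [this]
  have hfree : ∀ i, R₂.Free i ↔ R₁.Free i ∧ i ≠ x := RdqSource.free_assignLin_iff hx₁ hxp₁ hEq
  have hdim₂ : R₂.dim + 2 = R₀.dim := by
    have h1 := RdqSource.dim_assignLin hx₁ hxp₁ hEq
    have h2 := RdqSource.dim_assignFree (b := cy') hy hyp
    change R₂.dim + 1 = R₁.dim at h1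
    change R₁.dim + 1 = R₀.dim at h2
    omega
  have hE₁out : ∃ g₁, E₁.C'.out = .gate g₁ := by
    have e1 := E₁.out_eq; rw [if_neg hout₁G, hC₁out] at e1
    cases h1o : E₁.C'.out with
    | const cc => rw [h1o] at e1; change Node.const cc = Node.gate ko at e1; cases e1
    | var i => rw [h1o] at e1; change Node.var i = Node.gate ko at e1; cases e1
    | gate g₁ => exact ⟨g₁, rfl⟩
  have houtx : E₁.C'.out ≠ .var x := by obtain ⟨g₁, hg₁⟩ := hE₁out; rw [hg₁]; exact fun h => by cases h
  let C₂ := E₁.C'.substVar x t (finTwoEquiv (0 : ZMod 2))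
  have hF₂ : C₂.Fair := E₁.fair.substVar x t _
  have hC₂ : C₂.ComputesRestr f R₂ := E₁.computes.substVar htx hsol hfree ht₁ houtx
  have hwB : ∀ a, C₂.arg kB₁ a = .var t := by
    intro a
    show (E₁.C'.arg kB₁ a).substVar x t = .var t
    rw [Node.substVar_eq_var_target_iff]
    rcases fin2_eq_or_eq_rev aB a with e' | e'
    · rw [e']; exact Or.inl hB₁x
    · rw [e']; exact Or.inr hB₁t
  have hreadt₂ : ∀ k a, C₂.arg k a = .var t → k = kB₁ := by
    intro k a h
    change (E₁.C'.arg k a).substVar x t = .var t at h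
    rw [Node.substVar_eq_var_target_iff] at h
    rcases h with h | h
    · exact hreadx₁ k a h
    · exact hreadt₁ k a h
  have hxorB₂ : IsXorOp (C₂.op kB₁) := hxorB₁.comp_xor _ _
  obtain ⟨P₂, hP₂, hpot₂⟩ := exists_packing_substVar_of_not_and E₁.C' x t (finTwoEquiv (0 : ZMod 2)) htx E₁.packing
    (fun g a hg hand' => by
      have hg' : g = kB₁ := hreadt₂ g a hg
      rw [hg'] at hand'
      exact hand'.not_isXorOp hxorB₂)
  -- step 3: `B` is a constant gate
  obtain ⟨eB, heB⟩ := hxorB₂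
  have hid : ∀ (xx : Fin n → Bool) (w : Fin C₂.m → Bool),
      C₂.op kB₁ (C₂.nodeVal xx w (C₂.arg kB₁ 0)) (C₂.nodeVal xx w (C₂.arg kB₁ 1)) = eB := by
    intro xx w
    rw [hwB 0, hwB 1, heB]
    show ((xx t ^^ xx t) ^^ eB) = eB
    cases xx t <;> cases eB <;> rfl
  have hselfB : ∀ a, C₂.arg kB₁ a ≠ .gate kB₁ := by intro a h; rw [hwB a] at h; cases h
  have houtB : C₂.out ≠ .gate kB₁ :=
    out_ne_of_semConst hf (by omega) hF₂ hC₂ (fun xx w hw => by rw [hw kB₁]; exact hid xx w)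
  let E₃ := elimDataWRedirectConst hF₂ hC₂ hP₂ eB hid (Or.inl (by rw [hwB 0, hwB 1])) hselfB houtB hφ hI αQ
  have hr₃ : E₃.repl = .const eB := rfl
  -- `t` is a `0`-variable afterwards, unprotected
  have hft₃ : E₃.C'.fanout (.var t) = 0 := by
    have h0 : ∀ k' a, E₃.C'.arg k' a ≠ .var t := by
      intro k' a h
      rw [E₃.arg_eq_var_iff] at h
      rcases h with h | ⟨-, h⟩
      · exact E₃.ι_ne k' (hreadt₂ _ a h)
      · rw [hr₃] at h; cases h
    unfold fanout
    rw [Finset.sum_eq_zero]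
    intro k' _
    rw [card_eq_zero, filter_eq_empty_iff]
    exact fun a _ h => h0 k' a h
  have htp₂ : ¬ R₂.Protected t := fun h =>
    htp ((RdqSource.protected_assignFree_iff hy hyp t).mp ((RdqSource.protected_assignLin_iff hx₁ hxp₁ hEq t).mp h))
  -- accounting
  have hyinf : y ∈ C₀.influential R₀ := C₀.mem_influential_of_reads R₀ hGy
  have hμ₁ := measure_substConst_le hφ αI αQ hP₀ R₀ R₁ y (finTwoEquiv cy')
  have hinf₁ : (1 : ℝ) ≤ ((C₀.influential R₀).card : ℝ) - (C₁.influential R₁).card := by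
    have h1 : (C₁.influential R₁).card ≤ ((C₀.influential R₀).erase y).card :=
      card_le_card (C₀.influential_substConst_assignFree_subset hy hyp cy' (finTwoEquiv cy'))
    have h3 := card_erase_add_one hyinf
    have : (C₁.influential R₁).card + 1 ≤ (C₀.influential R₀).card := by omega
    have : ((C₁.influential R₁).card : ℝ) + 1 ≤ (C₀.influential R₀).card := by exact_mod_cast this
    linarith
  have hq₁ : ((R₀.quadCount : ℝ) - (R₁.quadCount : ℝ)) = 0 := by
    have : R₁.quadCount = R₀.quadCount := RdqSource.quadCount_assignFree hy hyp; rw [this]; ring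
  have hμE₁ := E₁.measure_le
  -- the affine substitution: `x` leaves, `t` stays (already influential), `Φ` does not increase
  have hxinf₁ : x ∈ E₁.C'.influential R₁ := E₁.C'.mem_influential_of_reads R₁ hB₁x
  have htinf₁ : t ∈ E₁.C'.influential R₁ := E₁.C'.mem_influential_of_reads R₁ hB₁t
  have hinf₂ : ((C₂.influential R₂).card : ℝ) + 1 ≤ (E₁.C'.influential R₁).card := by
    have hfreej : ¬ R₂.Free x := fun h => ((hfree x).mp h).2 rfl
    have hprot : ∀ i, R₂.Protected i → R₁.Protected i := fun i h => (RdqSource.protected_assignLin_iff hx₁ hxp₁ hEq i).mp h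
    have h1 := E₁.C'.influential_substVar_subset x t (finTwoEquiv (0 : ZMod 2)) htx hfreej hprot
    have h2 : insert t ((E₁.C'.influential R₁).erase x) = (E₁.C'.influential R₁).erase x :=
      insert_eq_of_mem (mem_erase.mpr ⟨htx, htinf₁⟩)
    rw [h2] at h1
    have h3 := card_le_card h1
    change (C₂.influential R₂).card ≤ _ at h3
    have h4 := card_erase_add_one hxinf₁
    have : (C₂.influential R₂).card + 1 ≤ (E₁.C'.influential R₁).card := by omega
    exact_mod_cast this
  have hq₂ : (R₂.quadCount : ℝ) = R₁.quadCount := rfl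
  have hpot₂' : (C₂.potential P₂ : ℝ) ≤ E₁.C'.potential E₁.P' := by exact_mod_cast hpot₂
  have hμ₂ : C₂.measure αφ αI αQ P₂ R₂ ≤ E₁.C'.measure αφ αI αQ E₁.P' R₁ - αI := by
    unfold measure
    rw [hq₂]
    show ((E₁.C'.m : ℕ) : ℝ) + _ + _ + _ ≤ _
    nlinarith [mul_le_mul_of_nonneg_left hinf₂ hI, mul_le_mul_of_nonneg_left hpot₂' hφ]
  -- the last elimination: `t` leaves too
  have htinf₂ : t ∈ C₂.influential R₂ := C₂.mem_influential_of_reads R₂ (hwB 0)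
  have hinf₃ : ((E₃.C'.influential R₂).card : ℝ) + 1 ≤ (C₂.influential R₂).card := by
    have hsub : E₃.C'.influential R₂ ⊆ (C₂.influential R₂).erase t := by
      intro i hi
      rw [mem_erase]
      refine ⟨fun hit => ?_, E₃.influential_subset R₂ hi⟩
      rw [hit] at hi
      unfold influential at hi; rw [mem_filter, hft₃] at hi
      rcases hi.2 with h | h
      · omega
      · exact htp₂ h
    have h1 := card_le_card hsub
    have h2 := card_erase_add_one htinf₂
    have : (E₃.C'.influential R₂).card + 1 ≤ (C₂.influential R₂).card := by omega
    exact_mod_cast this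
  have hm₃ : (E₃.C'.m : ℝ) + 1 = C₂.m := by exact_mod_cast E₃.m_add_one
  have hpot₃ := E₃.potential_le
  have hμ₃ : E₃.C'.measure αφ αI αQ E₃.P' R₂ ≤ C₂.measure αφ αI αQ P₂ R₂ - αI := by
    unfold measure
    nlinarith [mul_le_mul_of_nonneg_left hinf₃ hI, mul_le_mul_of_nonneg_left hpot₃ hφ, hφ1, hm₃]
  refine ⟨E₃.C', R₂, E₃.P', E₃.fair, E₃.computes, E₃.packing, hdim₂, ?_⟩
  rw [hq₁] at hμ₁
  have hαI₁ := mul_le_mul_of_nonneg_left hinf₁ hI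
  linarith [hμ₁, hμE₁, hμ₂, hμ₃, hαI₁]

variable {C : Semicircuit n} {R : RdqSource n} {G : Fin C.m} {x y : Fin n} {B C' D : Fin C.m} {aX aB aC aD : Fin 2}

/-- **Cases 5.4.1.4.1.3/4 of the proof of Thm. 4.1** (hypothesis `hQ13` of
`stepGoal_quadratic_aux`): `E` reads the non-∧-type `2`-gate `B = B(x, t)`, `t` a `1`-variable.
If `t` is unprotected: `quad13_core` (`Δμ ≥ 3α_I ≥ 2δ`, two substitutions); if `t` is protected:
first a constant to its couple (killing their quadratic equation), then `quad13_core`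
(`Δμ ≥ 4α_I ≥ 3δ`, three substitutions). [cite: LiYang2022, §4.1 (Cases 5.4.1.4.1.3, 5.4.1.4.1.4)] -/
theorem stepGoal_quad13 (hf : IsAffineDisperser f d) (hd : 2 * d + 2 < R.dim) (hF : C.Fair)
    (hC : C.ComputesRestr f R) (hS : C.Standing R) (hcfg : C.Case5Config G x y B C' D aX aB aC aD)
    (hφ0 : 0 < αφ) (hφ : αφ < 1 / 2) (hI0 : 0 < αI) (hQ0 : 0 < αQ) (hBC : B ≠ C')
    {u : Fin n} (hup : ¬ R.Protected u)
    {t : Fin n} (hBn : ¬ IsAndOp (C.op B)) (hBt : C.arg B aB.rev = .var t) (ht1 : C.fanout (.var t) = 1) :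
    C.StepGoal f R αφ αI αQ := by
  classical
  have hφ' := hφ0.le
  have hI' := hI0.le
  have hN := hS.normalized.1
  have hGK := hcfg.G_not_mem
  have hDK : D ∉ C.xorPart := fun hDK => hGK (C.mem_of_arg_eq D hDK aD G hcfg.arg_D)
  have hBx := hcfg.arg_B
  have hBxor : IsXorOp (C.op B) := C.isXorOp_of_isAffineOp hS.nonDegenerate ((isAndOp_or_isAffineOp _).resolve_left hBn)
  have hty : t ≠ y := fun h => case5_B_not_y hcfg hBC aB.rev (by rw [hBt, h])
  have htx : t ≠ x := by
    intro h
    have e : ∀ a', C.arg B a' = .var x := fun a' => by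
      rcases fin2_eq_or_eq_rev aB a' with h' | h'
      · rw [h']; exact hBx
      · rw [h', hBt, h]
    exact hN.arg_zero_ne_arg_one B (by rw [e 0, e 1])
  have hx : R.Free x := case5_free_x hC hcfg
  have hxp : ¬ R.Protected x := case5_unprot_x hS hcfg
  have hy : R.Free y := free_of_reads hC hcfg.arg_G_y
  have hyp : ¬ R.Protected y := case5_unprot_y hS hcfg
  have ht : R.Free t := free_of_reads hC hBt
  have hGout : C.out ≠ .gate G := out_ne_of_read_bYacyclic hS hDK ⟨aD, hcfg.arg_D⟩
  have hreadx : ∀ k a, C.arg k a = .var x → k = G ∨ k = B := fun k a h => case5_reader_x hcfg h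
  by_cases htp : R.Protected t
  swap
  · -- Case 5.4.1.4.1.3
    obtain ⟨C', R', P', hF', hC', hP', hdim', hμ'⟩ := quad13_core hf (by omega) hF hC C.isPacking_empty hφ' (by linarith) hI' αQ
      hcfg.and_G hcfg.arg_G_x hcfg.arg_G_y hBx hBt hBxor hcfg.B_ne_G hcfg.x_ne_y htx hty hreadx ht1 hx hxp hy hyp ht htp hGout
    refine Or.inr ⟨2, by norm_num, by norm_num, C', R', P', hF', hC', hP', hdim', ?_⟩
    have hδ := two_liYangDelta_le_three αφ hI' αQ
    push_cast
    linarith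
  · -- Case 5.4.1.4.1.4: first a constant to the couple `w` of `t`
    obtain ⟨-, l, e, he, hrt⟩ := htp
    obtain ⟨⟨-, -⟩, ⟨-, -⟩, hik⟩ := R.quad_wf l e he
    let w : Fin n := if e.i = t then e.k else e.i
    have hrw : e.Reads w := by
      show e.i = w ∨ e.k = w
      by_cases h : e.i = t
      · right; simp [w, h]
      · left; simp [w, h]
    have hwt : w ≠ t := by
      intro h'
      by_cases h : e.i = t
      · have : e.k = t := by simp only [w, if_pos h] at h'; exact h'
        exact hik (h.trans this.symm)
      · have : e.i = t := by simp only [w, if_neg h] at h'; exact h'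
        exact h this
    have hrt' : e.Reads t := hrt
    have hwprot : R.Protected w := by
      refine ⟨?_, l, e, he, hrw⟩
      rcases hrw with h | h
      · rw [← h]; exact ⟨(R.quad_wf l e he).1.1, (R.quad_wf l e he).1.2⟩
      · rw [← h]; exact ⟨(R.quad_wf l e he).2.1.1, (R.quad_wf l e he).2.1.2⟩
    have hwx : w ≠ x := fun h => hxp (h ▸ hwprot)
    have hwy : w ≠ y := fun h => hyp (h ▸ hwprot)
    have hwu : w ≠ u := fun h => hup (h ▸ hwprot)
    let C₀ := C.substConst w (finTwoEquiv (0 : ZMod 2))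
    let R₀ := R.assignProtected he hrw 0
    have hF₀ : C₀.Fair := hF.substConst w _
    have hC₀ : C₀.ComputesRestr f R₀ := hC.substConst_assignProtected he hrw 0
    have hP₀ : C₀.IsPacking (C.substConstPacking w (finTwoEquiv (0 : ZMod 2)) ∅) := C.isPacking_empty.substConst
    have hdim₀ : R₀.dim + 1 = R.dim := RdqSource.dim_assignProtected he hrw 0
    have hvar₀ : ∀ {k : Fin C.m} {a : Fin 2} {v : Fin n}, v ≠ w → (C₀.arg k a = .var v ↔ C.arg k a = .var v) := by
      intro k a v hvw
      show (C.arg k a).substConst w _ = .var v ↔ _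
      cases hka : C.arg k a with
      | const c => exact ⟨(fun h => by cases h), fun h => by cases h⟩
      | var i =>
        by_cases hiw : i = w
        · rw [hiw, Node.substConst_var_self]; exact ⟨(fun h => by cases h), fun h => by cases h; exact absurd rfl hvw⟩
        · rw [Node.substConst_var_of_ne hiw]
      | gate g => exact ⟨(fun h => by cases h), fun h => by cases h⟩
    have hfree₀ : ∀ i, R₀.Free i ↔ R.Free i ∧ i ≠ w := fun i => RdqSource.free_assignProtected_iff he hrw 0 i
    have hprot₀ : ∀ i, R₀.Protected i → R.Protected i := fun i h => RdqSource.protected_of_protected_assignProtected he hrw 0 h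
    have htp₀ : ¬ R₀.Protected t := RdqSource.not_protected_assignProtected_of_reads he hrw 0 hrt'
    obtain ⟨ko, hko⟩ := exists_out_eq_gate' hf hF hC (by omega)
    have hGout₀ : C₀.out ≠ .gate G := by
      show C.out.substConst w _ ≠ _; rw [hko]; exact fun h => hGout (by rw [hko]; exact h)
    obtain ⟨C', R', P', hF', hC', hP', hdim', hμ'⟩ := quad13_core (C₀ := C₀) (R₀ := R₀) hf (by omega) hF₀ hC₀ hP₀ hφ'
      (by linarith) hI' αQ (G := G) (B := B) (x := x) (y := y) (t := t) (aX := aX) (aB := aB)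
      hcfg.and_G ((hvar₀ hwx.symm).mpr hcfg.arg_G_x) ((hvar₀ hwy.symm).mpr hcfg.arg_G_y) ((hvar₀ hwx.symm).mpr hBx)
      ((hvar₀ hwt.symm).mpr hBt) hBxor hcfg.B_ne_G hcfg.x_ne_y htx hty
      (fun k a h => hreadx k a ((hvar₀ hwx.symm).mp h))
      (by rw [C.fanout_substConst_var_of_ne w _ hwt.symm]; exact ht1)
      ((hfree₀ x).mpr ⟨hx, hwx.symm⟩) (fun h => hxp (hprot₀ x h)) ((hfree₀ y).mpr ⟨hy, hwy.symm⟩) (fun h => hyp (hprot₀ y h))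
      ((hfree₀ t).mpr ⟨ht, hwt.symm⟩) htp₀ hGout₀
    refine Or.inr ⟨3, by norm_num, le_rfl, C', R', P', hF', hC', hP', by omega, ?_⟩
    -- the first substitution: `w` leaves the influential set, one quadratic equation is killed
    have hwinf : w ∈ C.influential R := by
      unfold influential; rw [mem_filter]; exact ⟨mem_univ _, Or.inr hwprot⟩
    have hμ₀ := measure_substConst_le hφ' αI αQ C.isPacking_empty R R₀ w (finTwoEquiv (0 : ZMod 2))
    have hinf₀ : (1 : ℝ) ≤ ((C.influential R).card : ℝ) - (C₀.influential R₀).card := by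
      have h1 : (C₀.influential R₀).card ≤ ((C.influential R).erase w).card :=
        card_le_card ((C.influential_substConst_assignProtected_subset he hrw 0 (finTwoEquiv (0 : ZMod 2))).trans (filter_subset _ _))
      have h3 := card_erase_add_one hwinf
      have : (C₀.influential R₀).card + 1 ≤ (C.influential R).card := by omega
      have : ((C₀.influential R₀).card : ℝ) + 1 ≤ (C.influential R).card := by exact_mod_cast this
      linarith
    have hq₀ : ((R.quadCount : ℝ) - (R₀.quadCount : ℝ)) = 1 := by
      have : R₀.quadCount + 1 = R.quadCount := RdqSource.quadCount_assignProtected he hrw 0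
      have : ((R₀.quadCount : ℝ)) + 1 = R.quadCount := by exact_mod_cast this
      linarith
    have hδ := three_liYangDelta_le_four αφ αI αQ
    rw [hq₀] at hμ₀
    have hαI := mul_le_mul_of_nonneg_left hinf₀ hI'
    push_cast
    nlinarith [hμ₀, hμ', hαI, hQ0.le]

end Semicircuit

end Literature.Computability.Complexity
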